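import Summits.CriticalPhenomena.PercolationContinuityZ3.Theorems.Transplant.PlanarSkeletonFrmScaledOfTight
import Summits.CriticalPhenomena.PercolationContinuityZ3.Theorems.Transplant.PlanarSkeletonFrmScaledRayHolds
import Summits.CriticalPhenomena.PercolationContinuityZ3.Theorems.Transplant.SkelFrmFromBChoiceSlotsPx
import Summits.CriticalPhenomena.PercolationContinuityZ3.Theorems.Transplant.SkelFrmFromBChoiceGeomVPx
import Summits.CriticalPhenomena.PercolationContinuityZ3.Theorems.Transplant.SkelFrmFrom1RootHoldsQ3VNodePx
import Summits.CriticalPhenomena.PercolationContinuityZ3.Theorems.Transplant.SkelFrmFrom1FaceHoldsQ3VNodePx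
import Summits.CriticalPhenomena.PercolationContinuityZ3.Theorems.Transplant.SkelFrmFrom1ReachHoldsQ3VNodePx
import HarnessLib

/-!
# RUNG U_s NODE FILE (RULING D-Us / Us-R5 / Us-R6, lead g22; staged by the design owner p3-g27 2026-08-27; filed ONLY under the lead's Us-4 rule after
# «PROBE PASS»): **the scaled one-type node `SamePDropOfSkeletonFrmScaled₁` holds** — the EXISTING `@[conjecture]` («PlanarSkeletonFrmScaledDefs» :160, NOT edited)
# concluded BY NAME from the four GEN column tops at the TUPLE Px OF RECORD («SkelFrmFromBChoiceSlotsPx»), through p5-g26's rider-free closing lemma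
# `PlanarSkeletonFrmScaled.samePDropOfSkeletonFrmScaled₁_of_choiceFnNQLTKPxAt` (shape (a) of RULING Us-R5)

builds on p205010 (kernel theorem, internal audit signed; external expert review pending).  PROVENANCE: `𝒞f := fun D => frmChoiceAllQ3VPx D (gvPx D) (fvPx D) (PvPx D)
(SUS (exPx D) (mxPx D)) (cvPx D) (hvPx D) BSlot.small3` (the U node tuple READ AT THE RAISED KIT INDEX `KS.RK t Drec 0 + D`, K-2, TUPLE COHERENCE RULE-Px); the four
obligations ∀ D: Geom `PlanarSkeletonFrmFrom.geomHoldsNQFnPxAt_frmChoiceAllQ3VPx` (gen-1, p465798) · (R) `PlanarSkeletonFrmFrom.NegB.rootHoldsNQWFnLKPxAt_frmChoiceAllQ3VPx_node`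
(p3, «SkelFrmFrom1RootHoldsQ3VNodePx» p473968) · (F) `PlanarSkeletonFrmFrom.NegB.faceHoldsRNQFnLTKPxAt_frmChoiceAllQ3VPx_node` (gen-1 g2, «SkelFrmFrom1FaceHoldsQ3VNodePx») · (C) `PlanarSkeletonFrmFrom.reachHoldsRHNQFnLKPxAt_frmChoiceAllQ3VPx_node` (gen-1, «SkelFrmFrom1ReachHoldsQ3VNodePx» p475664); `Lf := PlanarSkeletonFrm.NegB.LfQ`, `dT := (·^3)`, `Kmin := 480`.
No mathematics lives here.  §2 gives the normal forms customers cite (U as a corollary is NOT restated: it is the landed `samePDropOfSkeletonFrmFrom₁_holds`, gate dedup).  Until this file is ACCEPTED nothing about `SamePDropOfSkeletonFrmScaled₁` is claimed anywhere.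
[cite: BenjaminiSchramm1996, Conj. 4] [cite: KozmaNitzan2024, §1 p. 2 (approach 1); §4 (Lemma 8, Lemma 12, Theorem 6)] [cite: Hutchcroft2016, Thm. 1.1] [cite: LyonsPeres2016, Thm. 7.6]
-/

noncomputable section

namespace Summit.CriticalPhenomena.PercolationContinuityZ3.Theorems

namespace Transplant

open MeasureTheory Literature.Probability.Percolation Literature.Probability.LatticeModels SimpleGraph
open scoped Classical

/-! ## §1 The node -/

/-- **THE SCALED ONE-TYPE NODE HOLDS**: `SamePDropOfSkeletonFrmScaled₁` — for every connected, locally finite, countable graph carrying a one-type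
`PlanarSkeletonFrmScaled` (any Lipschitz constant `L`, any step `N`), every `p < 1` with a.s. uniqueness, subcritical cylinders and `θ_t(p) > 0` admits `q < p`
with `θ_t(q) > 0`.  The four-of-four composition of the GEN columns at the tuple of record under proxies, through the rider-free closing lemma.
builds on p205010 (kernel theorem, internal audit signed; external expert review pending). [cite: BenjaminiSchramm1996, Conj. 4] [cite: KozmaNitzan2024, §4] -/
theorem samePDropOfSkeletonFrmScaled₁_holds : SamePDropOfSkeletonFrmScaled₁ :=
  PlanarSkeletonFrmScaled.samePDropOfSkeletonFrmScaled₁_of_choiceFnNQLTKPxAt PlanarSkeletonFrm.NegB.LfQ (fun x : ℝ => x ^ 3) (fun _ hx => pow_pos hx 3) 480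
    (fun D => PlanarSkeletonFrmFrom.frmChoiceAllQ3VPx D (PlanarSkeletonFrmFrom.NegB.gvPx D) (PlanarSkeletonFrmFrom.NegB.fvPx D) (PlanarSkeletonFrmFrom.NegB.PvPx D)
      (PlanarSkeletonFrmFrom.NegB.SUS (PlanarSkeletonFrmFrom.NegB.exPx D) (PlanarSkeletonFrmFrom.NegB.mxPx D)) (PlanarSkeletonFrmFrom.NegB.cvPx D)
      (PlanarSkeletonFrmFrom.NegB.hvPx D) PlanarSkeletonFrmFrom.NegB.BSlot.small3)
    (fun D => PlanarSkeletonFrmFrom.geomHoldsNQFnPxAt_frmChoiceAllQ3VPx D _ _ _ _ _ _ _)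
    (fun D => PlanarSkeletonFrmFrom.NegB.rootHoldsNQWFnLKPxAt_frmChoiceAllQ3VPx_node D 480 (by norm_num))
    (fun D => PlanarSkeletonFrmFrom.NegB.faceHoldsRNQFnLTKPxAt_frmChoiceAllQ3VPx_node D 480 le_rfl)
    (fun D => PlanarSkeletonFrmFrom.reachHoldsRHNQFnLKPxAt_frmChoiceAllQ3VPx_node D 480 (by norm_num))

/-! ## §2 The normal forms -/

/-- **THE NODE AS CONTINUITY** (normal form `samePDropOfSkeletonFrmScaled₁_iff_continuity`, «PlanarSkeletonFrmScaledRayHolds»): `θ_t(p_c) = 0` on every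
connected, locally finite, countable graph carrying a one-type `PlanarSkeletonFrmScaled` — `p_c < 1`, uniqueness and Φ2 come from the skeleton.
builds on p205010 (kernel theorem, internal audit signed; external expert review pending). [cite: BenjaminiSchramm1996, Conj. 4] -/
theorem frmScaled₁CriticalContinuity_holds :
    ∀ {V : Type} [DecidableEq V] [Countable V] (G : SimpleGraph V) [G.LocallyFinite] (Φ : PlanarSkeletonFrmScaled G),
      G.Connected → ∀ t ∈ Φ.types, Φ.types = {t} → theta G t (criticalProbIOf G t) = 0 :=
  samePDropOfSkeletonFrmScaled₁_iff_continuity.1 samePDropOfSkeletonFrmScaled₁_holds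

/-- **THE NODE AT EVERY VERTEX** (`continuity_of_frmScaledNode₁_ray` DISCHARGED): on a locally finite graph with a one-type `PlanarSkeletonFrmScaled`,
`θ_v(p_c(v)) = 0` at every vertex `v` (connectedness and Φ2 from the skeleton).
builds on p205010 (kernel theorem, internal audit signed; external expert review pending). [cite: BenjaminiSchramm1996, Conj. 4] -/
theorem frmScaled₁CriticalContinuity_holds_ray {V : Type} (G : SimpleGraph V) [G.LocallyFinite] (Φ : PlanarSkeletonFrmScaled G) (t : V)
    (ht : t ∈ Φ.types) (h1 : Φ.types = {t}) (v : V) : theta G v (criticalProbIOf G v) = 0 :=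
  continuity_of_frmScaledNode₁_ray samePDropOfSkeletonFrmScaled₁_holds G Φ t ht h1 v

end Transplant

end Summit.CriticalPhenomena.PercolationContinuityZ3.Theorems

end
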